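import Literature.AnabelianGeometry.SemiGraphs.TemperoidsGaloisHomTorsor
import Literature.AlgebraicGeometry.Frobenioids.MonoidFunctors
import Literature.AnabelianGeometry.EtaleTheta.FrobenioidThetaDivisors
import Literature.AnabelianGeometry.EtaleTheta.Discharge.Sec5OfConnectedTemperoid

/-!
# [EtTh] Thm. 5.6/5.7 via Prop. 5.3 (vi): an `Aut_C(A_⊚)`-orbit element LIFTS to an automorphism of the root domain `A_N`
# (GAP-LEDGER G-w5d245-2, LINK (d): "the `Aut_C(A_⊚)`-orbit element `g ↦` an automorphism `e` of `A_N` over it")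

Mochizuki, *The étale theta function …*, Publ. RIMS **45** (2009): Prop. 5.3 (vi) p.326 (PDF p.100) "`Ψ^Φ_{A_⊚}` preserves
the `Aut_C(A_⊚)`-orbit of the divisor of zeroes and poles `∈ Φ(A_⊚)^gp` of … `Θ̈`"; proof of Thm. 5.6 p.329 (PDF p.103) "since
`Ψ` [essentially] preserves the divisor of zeroes and poles of `Θ̈` [cf. Proposition 5.3, (vi)], it follows … that there exist
isomorphisms `γ₁ : S₁ ⥲ T₁`, `γ₂ : S₂ ⥲ T₂` …"; Thm. 5.7 p.329–330 (PDF pp.103–104).  The word "essentially" is an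
`Aut_C(A_⊚)`-translate; to read it AT THE ROOT PAIR `s^⊓_N, s^⊔_N : A_N → B_N` (abc-iut-L2-d4's binder `hdiv`, an
`∃ e : A_N ≅ A_N`) that translate must be lifted along `A_N^bs → A_⊚^bs`:
* [SemiAnbd] Rmk. 3.1.3 p.34 (Def. 3.1 (iv) p.33): a Galois object of `B^temp(Π)` is an `Aut`-torsor over every connected
  target, so every endomorphism of the target LIFTS (`GaloisObjects.exists_aut_over_of_isGaloisObj(_connectedPart)`);
* [FrdI] Prop. 5.6 p.105 / Thm. 5.2 (ii) p.101: a Frobenius-trivial object `A` of the model Frobenioid carries a section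
  `Aut_D(A^bs) → Aut_C(A)` (the tree's `ModelFrobenioid.frobTrivSection`; at the §5 data: `s^trv_N`, `StrvSection`), so the
  base lift LIFTS AGAIN to `Aut_C(A_N)` (`ModelFrobenioid.exists_aut_baseMap_eq`, `…_comp_eq_of_isGaloisObj`);
* the divisor dictionary: a square `e^bs ≫ a = a ≫ g^bs` INTERTWINES the pull-back actions — `a^* ∘ (g⁻¹)^bs{}^* =
  (e⁻¹)^bs{}^* ∘ a^*` on `Φ` and on `Φ^gp` (`ThetaFrobenioid.pull_pullAut_eq_pullAut_pull`, `…gpMap…`); hence the pull-back to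
  `A_N` of the `Aut_C(A_⊚)`-orbit of `div(Θ̈)` lies in the `Aut_C(A_N)`-orbit of its pull-back, and Prop. 5.3 (vi)
  (`FrobenioidThetaDivisors.PreservesThetaDivisorOrbit`, row F-0564) yields
  `a^*((Ψ^Φ_{A_⊚})^gp div Θ̈) = (e⁻¹)^bs{}^* (a^* div Θ̈)` for some `e ∈ Aut_C(A_N)` (`exists_aut_AN_of_preservesThetaDivisorOrbit`).
At the GENUINE §5 data `ThetaFrobenioid.ofConnectedTemperoidData …` over `B^temp(Π^tp_X)⁰` (abc-iut-L2-t4) BOTH inputs are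
theorems (`A_N^bs` Galois: `R.αData.isGalois`, Def. 4.1 (iv)(a); `s^trv_N` a section: `strvSection_ofConnectedTemperoidData`):
`exists_aut_over_ofConnectedTemperoidData`, `exists_aut_AN_of_preservesThetaDivisorOrbit_ofConnectedTemperoidData` — LINK (d)
with NO residual hypothesis.  [cite: MochizukiEtTh2009, Prop 5.3 (vi) p.326 (PDF p.100); Thm 5.6 proof p.329 (PDF p.103)]
[cite: MochizukiSemiAnbd2006, Rmk 3.1.3 p.34] [cite: MochizukiFrdI2008, Prop. 5.6 p.105]

abc-iut cell, layer L2, ROWS #17 **R314** (abc-iut-L2-lead gen 4): GAP G-w5d245-2 LINK (d), seat abc-iut-f-123 (gen 3).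
PROOF-ONLY (0 definitions, no new named fact).  Links (a) [FrdI] Thm. 4.9 divisor clause, (b) the `A_⊚ ↔ A_N` dictionary for
`div(Θ̈)`, (c) the cuspidal/non-cuspidal splitting are OTHER seats' rows and are not touched.  HONEST FRAMING: kernel-checked
category/monoid bookkeeping over the typed §4/§5 structures; nothing here asserts a result of [EtTh] for an actual curve;
typed ≠ proved; no side taken on [IUTchIII] Cor. 3.12.
-/

open CategoryTheory Opposite

/-! ## §1. [SemiAnbd] Rmk. 3.1.3: endomorphisms of a connected target lift to automorphisms of a Galois source -/

namespace Literature.AnabelianGeometry.SemiGraphs.GaloisObjects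

open Literature.AlgebraicGeometry.Frobenioids (IsConnectedObj ConnectedPart)

universe u

variable {G : Type u} [Group G] [TopologicalSpace G]

/-- **Lifting along a Galois object** ([SemiAnbd] Rmk. 3.1.3 / Def. 3.1 (iv), dual torsor form): for `A` Galois and `T`
connected in `B^temp(Π)`, a morphism `a : A → T` and ANY endomorphism `t` of `T`, there is `σ ∈ Aut(A)` OVER `t`:
`σ ≫ a = a ≫ t`.  [cite: MochizukiSemiAnbd2006, Rmk 3.1.3 p.34] -/
theorem exists_aut_over_of_isGaloisObj (A T : BTemp G) (hA : IsGaloisObj A) (hT : IsConnectedObj T) (a : A ⟶ T)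
    (t : T ⟶ T) : ∃ σ : Aut A, σ.hom ≫ a = a ≫ t := by
  obtain ⟨σ, hσ⟩ := exists_aut_comp_eq_of_isGaloisObj A T hA hT a (a ≫ t)
  exact ⟨σ, hσ.symm⟩

/-- **Lifting along a Galois object in `B^temp(Π)⁰`** (the base category `D` of [EtTh] §3–§5): for `A` Galois, any `T`,
`a : A → T` and any endomorphism `t` of `T` there is `σ ∈ Aut(A)` with `σ ≫ a = a ≫ t` — in particular every
`g ∈ Aut_D(A_⊚^bs)` lifts along `A_N^bs → A_⊚^bs` to `Aut_D(A_N^bs)` (`A_N^bs` Galois, [EtTh] Def. 4.1 (iv)(a)).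
[cite: MochizukiSemiAnbd2006, Rmk 3.1.3 p.34] -/
theorem exists_aut_over_of_isGaloisObj_connectedPart (A T : ConnectedPart (BTemp G)) (hA : IsGaloisObj A.obj)
    (a : A ⟶ T) (t : T ⟶ T) : ∃ σ : Aut A, σ.hom ≫ a = a ≫ t := by
  obtain ⟨σ, hσ⟩ := exists_aut_comp_eq_of_isGaloisObj_connectedPart A T hA a (a ≫ t)
  exact ⟨σ, hσ.symm⟩

end Literature.AnabelianGeometry.SemiGraphs.GaloisObjects

/-! ## §2. [FrdI] Prop. 5.6: base automorphisms of a Frobenius-trivial object lift to the model Frobenioid -/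

namespace Literature.AlgebraicGeometry.Frobenioids.ModelFrobenioid

universe w v u

section AnyBase

variable {D : Type u} [Category.{v} D] {Φ B : Dᵒᵖ ⥤ CommMonCat.{w}} {DivB : B ⟶ monoidGp Φ}

/-- **Every `τ ∈ Aut_D(X^bs)` lifts to `Aut_C(X)`** for a Frobenius-trivial object `X` of the model Frobenioid ([FrdI]
Prop. 5.6: the section "arising from a base-Frobenius pair", the tree's `frobTrivSection`).  [cite: MochizukiFrdI2008, Prop. 5.6 p.105] -/
theorem exists_aut_baseMap_eq (h : Hypotheses Φ B) (X : ModelFrobenioid Φ B DivB)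
    (hX : PreFrobenioid.IsFrobeniusTrivial (toElem Φ B DivB) X) (τ : Aut X.base) :
    ∃ e : Aut X, baseMap e.hom = τ.hom :=
  ⟨frobTrivSection h X hX τ, baseMap_frobTrivSection h X hX τ⟩

end AnyBase

section ConnectedTemperoidBase

open Literature.AnabelianGeometry.SemiGraphs

variable {G : Type u} [Group G] [TopologicalSpace G] {Φ B : (ConnectedPart (BTemp G))ᵒᵖ ⥤ CommMonCat.{w}}
  {DivB : B ⟶ monoidGp Φ}

/-- **LINK (d), `C`-level, over `D = B^temp(Π)⁰`**: for a Frobenius-trivial object `X` of the model Frobenioid whose base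
`X^bs` is Galois, ANY object `Y`, a base arrow `a : X^bs → Y^bs` and `g ∈ Aut_C(Y)`, there is `e ∈ Aut_C(X)` OVER `g`
on bases: `e^bs ≫ a = a ≫ g^bs` ([SemiAnbd] Rmk. 3.1.3 + [FrdI] Prop. 5.6).
[cite: MochizukiFrdI2008, Prop. 5.6 p.105] [cite: MochizukiSemiAnbd2006, Rmk 3.1.3 p.34] -/
theorem exists_aut_baseMap_comp_eq_of_isGaloisObj (h : Hypotheses Φ B) (X Y : ModelFrobenioid Φ B DivB)
    (hX : PreFrobenioid.IsFrobeniusTrivial (toElem Φ B DivB) X) (hG : IsGaloisObj X.base.obj) (a : X.base ⟶ Y.base)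
    (g : Aut Y) : ∃ e : Aut X, baseMap e.hom ≫ a = a ≫ baseMap g.hom := by
  obtain ⟨σ, hσ⟩ := GaloisObjects.exists_aut_over_of_isGaloisObj_connectedPart X.base Y.base hG a (baseMap g.hom)
  obtain ⟨e, he⟩ := exists_aut_baseMap_eq h X hX σ
  exact ⟨e, by rw [he]; exact hσ⟩

end ConnectedTemperoidBase

end Literature.AlgebraicGeometry.Frobenioids.ModelFrobenioid

/-! ## §3. The divisor dictionary: a square `e^bs ≫ a = a ≫ g^bs` intertwines the pull-back actions on `Φ` and `Φ^gp` -/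

namespace Literature.AnabelianGeometry.EtaleTheta

open Literature.AlgebraicGeometry.Frobenioids

universe w v v' u u'

namespace ThetaFrobenioid

section Generic

variable {C : Type u} [Category.{v} C] {D : Type u'} [Category.{v'} D] (𝔉 : ThetaFrobenioid.{w} C D)

/-- From a square `F(e) ≫ a = a ≫ F(g)` of a functor `F` on automorphisms `e`, `g` to the square of the inverses
`F(e⁻¹) ≫ a = a ≫ F(g⁻¹)` (category bookkeeping for "`e` lies over `g`").  [cite: MochizukiEtTh2009, Prop 5.3 (vi) p.326 (PDF p.100)] -/
theorem map_inv_comp_eq_of_map_hom_comp_eq (F : C ⥤ D) {S T : C} {e : Aut S} {g : Aut T} {a : F.obj S ⟶ F.obj T}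
    (hsq : F.map e.hom ≫ a = a ≫ F.map g.hom) : F.map e.inv ≫ a = a ≫ F.map g.inv := by
  have h1 : (F.mapIso e).inv ≫ a = a ≫ (F.mapIso g).inv := by
    rw [Iso.inv_comp_eq, ← Category.assoc, Iso.eq_comp_inv, Functor.mapIso_hom, Functor.mapIso_hom]
    exact hsq.symm
  simpa only [Functor.mapIso_inv] using h1

/-- The `Aut_C(S)`-action on `Φ(S)` is pull-back along `(g⁻¹)^bs` (unfolding `pullAut`).
[cite: MochizukiEtTh2009, Prop 5.3 (vi) p.326 (PDF p.100)] -/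
theorem pullAut_apply {S : C} (g : Aut S) (x : 𝔉.pre.Mon (𝔉.base.obj S)) :
    𝔉.pullAut g x = 𝔉.pre.pull (𝔉.base.map g.inv) x := rfl

/-- As a monoid homomorphism the action of `g` IS `((g⁻¹)^bs)^*`. [cite: MochizukiEtTh2009, Prop 5.3 (vi) p.326 (PDF p.100)] -/
theorem coe_pullAut {S : C} (g : Aut S) :
    (𝔉.pullAut g : 𝔉.pre.Mon (𝔉.base.obj S) →* 𝔉.pre.Mon (𝔉.base.obj S)) = 𝔉.pre.pull (𝔉.base.map g.inv) :=
  MonoidHom.ext fun _ => rfl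

/-- `Φ^gp`-extension of an endomorphism (`ThetaFrobenioid.gpMap`) IS the tree's functorial `gpMap` ([FrdI] §0).
[cite: MochizukiFrdI2008, §0 p.11] -/
theorem gpMap_eq_gpMap {M : Type w} [CommMonoid M] (e : M →* M) :
    ThetaFrobenioid.gpMap e = AlgebraicGeometry.Frobenioids.gpMap e := rfl

/-- The identity acts trivially: `pullAut 1 = id` on `Φ(S)`. [cite: MochizukiEtTh2009, Prop 5.3 (vi) p.326 (PDF p.100)] -/
theorem pullAut_one_apply {S : C} (x : 𝔉.pre.Mon (𝔉.base.obj S)) : 𝔉.pullAut (1 : Aut S) x = x := by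
  rw [pullAut_apply]
  change 𝔉.pre.pull (𝔉.base.map (𝟙 S)) x = x
  rw [CategoryTheory.Functor.map_id, 𝔉.pre.pull_id]

/-- … and on `Φ(S)^gp`. [cite: MochizukiEtTh2009, Prop 5.3 (vi) p.326 (PDF p.100)] -/
theorem gpMap_pullAut_one_apply {S : C} (ξ : Algebra.GrothendieckGroup (𝔉.pre.Mon (𝔉.base.obj S))) :
    ThetaFrobenioid.gpMap (𝔉.pullAut (1 : Aut S) : 𝔉.pre.Mon (𝔉.base.obj S) →* 𝔉.pre.Mon (𝔉.base.obj S)) ξ = ξ := by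
  have h1 : (𝔉.pullAut (1 : Aut S) : 𝔉.pre.Mon (𝔉.base.obj S) →* 𝔉.pre.Mon (𝔉.base.obj S)) = MonoidHom.id _ :=
    MonoidHom.ext fun x => 𝔉.pullAut_one_apply x
  rw [h1, gpMap_eq_gpMap, AlgebraicGeometry.Frobenioids.gpMap_id, MonoidHom.id_apply]

variable {𝔉}

/-- From the square `e^bs ≫ a = a ≫ g^bs` to the square of inverses `(e⁻¹)^bs ≫ a = a ≫ (g⁻¹)^bs`.
[cite: MochizukiEtTh2009, Prop 5.3 (vi) p.326 (PDF p.100)] -/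
theorem base_map_inv_comp_eq {S T : C} {e : Aut S} {g : Aut T} {a : 𝔉.base.obj S ⟶ 𝔉.base.obj T}
    (hsq : 𝔉.base.map e.hom ≫ a = a ≫ 𝔉.base.map g.hom) : 𝔉.base.map e.inv ≫ a = a ≫ 𝔉.base.map g.inv :=
  map_inv_comp_eq_of_map_hom_comp_eq 𝔉.base hsq

/-- **The divisor dictionary of LINK (d)**: if `e ∈ Aut_C(S)` lies over `g ∈ Aut_C(T)` along `a : S^bs → T^bs`
(`e^bs ≫ a = a ≫ g^bs`), then pulling back along `a` INTERTWINES the two actions on divisor monoids: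
`a^*(g · x) = e · a^*(x)` for `x ∈ Φ(T)` (`g · x = ((g⁻¹)^bs)^* x`).  [cite: MochizukiEtTh2009, Prop 5.3 (vi) p.326 (PDF p.100)] -/
theorem pull_pullAut_eq_pullAut_pull {S T : C} {e : Aut S} {g : Aut T} {a : 𝔉.base.obj S ⟶ 𝔉.base.obj T}
    (hsq : 𝔉.base.map e.hom ≫ a = a ≫ 𝔉.base.map g.hom) (x : 𝔉.pre.Mon (𝔉.base.obj T)) :
    𝔉.pre.pull a (𝔉.pullAut g x) = 𝔉.pullAut e (𝔉.pre.pull a x) := by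
  rw [pullAut_apply, pullAut_apply, ← 𝔉.pre.pull_comp, ← 𝔉.pre.pull_comp, base_map_inv_comp_eq hsq]

/-- The same as an identity of monoid homomorphisms `Φ(T) → Φ(S)`: `a^* ∘ (g ·) = (e ·) ∘ a^*`.
[cite: MochizukiEtTh2009, Prop 5.3 (vi) p.326 (PDF p.100)] -/
theorem pull_comp_pullAut_eq {S T : C} {e : Aut S} {g : Aut T} {a : 𝔉.base.obj S ⟶ 𝔉.base.obj T}
    (hsq : 𝔉.base.map e.hom ≫ a = a ≫ 𝔉.base.map g.hom) :
    (𝔉.pre.pull a).comp (𝔉.pullAut g : 𝔉.pre.Mon (𝔉.base.obj T) →* 𝔉.pre.Mon (𝔉.base.obj T)) =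
      (𝔉.pullAut e : 𝔉.pre.Mon (𝔉.base.obj S) →* 𝔉.pre.Mon (𝔉.base.obj S)).comp (𝔉.pre.pull a) :=
  MonoidHom.ext fun x => pull_pullAut_eq_pullAut_pull hsq x

/-- **The divisor dictionary of LINK (d) on `Φ^gp`** (where `div(Θ̈)` lives, Prop. 5.3 (vi)): `(a^*)^gp ((g ·)^gp ξ) =
(e ·)^gp ((a^*)^gp ξ)` for `ξ ∈ Φ(T)^gp`.  [cite: MochizukiEtTh2009, Prop 5.3 (vi) p.326 (PDF p.100)] -/
theorem gpMap_pull_gpMap_pullAut {S T : C} {e : Aut S} {g : Aut T} {a : 𝔉.base.obj S ⟶ 𝔉.base.obj T}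
    (hsq : 𝔉.base.map e.hom ≫ a = a ≫ 𝔉.base.map g.hom) (ξ : Algebra.GrothendieckGroup (𝔉.pre.Mon (𝔉.base.obj T))) :
    AlgebraicGeometry.Frobenioids.gpMap (𝔉.pre.pull a)
        (ThetaFrobenioid.gpMap (𝔉.pullAut g : 𝔉.pre.Mon (𝔉.base.obj T) →* 𝔉.pre.Mon (𝔉.base.obj T)) ξ) =
      ThetaFrobenioid.gpMap (𝔉.pullAut e : 𝔉.pre.Mon (𝔉.base.obj S) →* 𝔉.pre.Mon (𝔉.base.obj S))
        (AlgebraicGeometry.Frobenioids.gpMap (𝔉.pre.pull a) ξ) := by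
  have h1 : (AlgebraicGeometry.Frobenioids.gpMap (𝔉.pre.pull a)).comp
      (AlgebraicGeometry.Frobenioids.gpMap (𝔉.pullAut g : 𝔉.pre.Mon (𝔉.base.obj T) →* 𝔉.pre.Mon (𝔉.base.obj T))) =
      (AlgebraicGeometry.Frobenioids.gpMap
          (𝔉.pullAut e : 𝔉.pre.Mon (𝔉.base.obj S) →* 𝔉.pre.Mon (𝔉.base.obj S))).comp
        (AlgebraicGeometry.Frobenioids.gpMap (𝔉.pre.pull a)) := by
    rw [← AlgebraicGeometry.Frobenioids.gpMap_comp, ← AlgebraicGeometry.Frobenioids.gpMap_comp,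
      pull_comp_pullAut_eq hsq]
  rw [gpMap_eq_gpMap, gpMap_eq_gpMap]
  exact DFunLike.congr_fun h1 ξ

/-- **LINK (d) — the `Aut_C(T)`-orbit pulls back INTO the `Aut_C(S)`-orbit**: if every `g ∈ Aut_C(T)` has an `e ∈ Aut_C(S)`
over it along `a`, then for every `δ ∈ Φ(T)^gp` (e.g. `div(Θ̈) ∈ Φ(A_⊚)^gp`) the `(a^*)^gp`-image of the `Aut_C(T)`-orbit of
`δ` is contained in the `Aut_C(S)`-orbit of `(a^*)^gp δ`.  [cite: MochizukiEtTh2009, Prop 5.3 (vi) p.326 (PDF p.100)] -/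
theorem image_orbit_subset_orbit_of_lifts {S T : C} {a : 𝔉.base.obj S ⟶ 𝔉.base.obj T}
    (hlift : ∀ g : Aut T, ∃ e : Aut S, 𝔉.base.map e.hom ≫ a = a ≫ 𝔉.base.map g.hom)
    (δ : Algebra.GrothendieckGroup (𝔉.pre.Mon (𝔉.base.obj T))) :
    AlgebraicGeometry.Frobenioids.gpMap (𝔉.pre.pull a) ''
        (Set.range fun g : Aut T =>
          ThetaFrobenioid.gpMap (𝔉.pullAut g : 𝔉.pre.Mon (𝔉.base.obj T) →* 𝔉.pre.Mon (𝔉.base.obj T)) δ) ⊆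
      Set.range fun e : Aut S =>
        ThetaFrobenioid.gpMap (𝔉.pullAut e : 𝔉.pre.Mon (𝔉.base.obj S) →* 𝔉.pre.Mon (𝔉.base.obj S))
          (AlgebraicGeometry.Frobenioids.gpMap (𝔉.pre.pull a) δ) := by
  rintro _ ⟨_, ⟨g, rfl⟩, rfl⟩
  obtain ⟨e, he⟩ := hlift g
  exact ⟨e, (gpMap_pull_gpMap_pullAut he δ).symm⟩

/-- Under `StrvSection` the value `s^trv_N(σ)` lies over `σ`: `(s^trv_N σ)^bs = σ` on arrows.
[cite: MochizukiEtTh2009, §5 p.331 (PDF p.105)] -/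
theorem base_map_strv_hom (hstrv : 𝔉.StrvSection) (σ : Aut (𝔉.base.obj 𝔉.AN)) :
    𝔉.base.map (𝔉.strv σ).hom = σ.hom :=
  congrArg Iso.hom (hstrv σ)

/-- **Existence of the lift from the two printed inputs** (generic §5 data): if `s^trv_N` is a SECTION (`StrvSection`,
[FrdI] Prop. 5.6) and `A_N^bs` is an `Aut`-torsor over `T^bs` ([SemiAnbd] Rmk. 3.1.3 — the law `hGal`, a theorem over
`B^temp(Π^tp_X)⁰`), then every `g ∈ Aut_C(T)` has `e := s^trv_N(σ) ∈ Aut_C(A_N)` over it along any `a : A_N^bs → T^bs`.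
[cite: MochizukiEtTh2009, §5 p.330–331 (PDF pp.104–105)] [cite: MochizukiSemiAnbd2006, Rmk 3.1.3 p.34] -/
theorem exists_strv_over_of_strvSection (hstrv : 𝔉.StrvSection) {T : C}
    (hGal : ∀ (a : 𝔉.base.obj 𝔉.AN ⟶ 𝔉.base.obj T) (t : 𝔉.base.obj T ⟶ 𝔉.base.obj T),
      ∃ σ : Aut (𝔉.base.obj 𝔉.AN), σ.hom ≫ a = a ≫ t)
    (a : 𝔉.base.obj 𝔉.AN ⟶ 𝔉.base.obj T) (g : Aut T) :
    ∃ σ : Aut (𝔉.base.obj 𝔉.AN), 𝔉.base.map (𝔉.strv σ).hom ≫ a = a ≫ 𝔉.base.map g.hom := by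
  obtain ⟨σ, hσ⟩ := hGal a (𝔉.base.map g.hom)
  refine ⟨σ, ?_⟩
  rw [base_map_strv_hom hstrv]
  exact hσ

/-- **LINK (d) at generic §5 data, packaged**: under `StrvSection` and the torsor law `hGal`, for every `a : A_N^bs → T^bs`
and `g ∈ Aut_C(T)` there is `e ∈ Aut_C(A_N)` over `g` (`e^bs ≫ a = a ≫ g^bs`) which intertwines the pull-back actions on
`Φ` and `Φ^gp`.  [cite: MochizukiEtTh2009, Prop 5.3 (vi) p.326 (PDF p.100); Thm 5.6 proof p.329 (PDF p.103)] -/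
theorem exists_aut_AN_over_of_strvSection (hstrv : 𝔉.StrvSection) {T : C}
    (hGal : ∀ (a : 𝔉.base.obj 𝔉.AN ⟶ 𝔉.base.obj T) (t : 𝔉.base.obj T ⟶ 𝔉.base.obj T),
      ∃ σ : Aut (𝔉.base.obj 𝔉.AN), σ.hom ≫ a = a ≫ t)
    (a : 𝔉.base.obj 𝔉.AN ⟶ 𝔉.base.obj T) (g : Aut T) :
    ∃ e : Aut 𝔉.AN, 𝔉.base.map e.hom ≫ a = a ≫ 𝔉.base.map g.hom ∧
      (∀ x : 𝔉.pre.Mon (𝔉.base.obj T), 𝔉.pre.pull a (𝔉.pullAut g x) = 𝔉.pullAut e (𝔉.pre.pull a x)) ∧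
      ∀ ξ : Algebra.GrothendieckGroup (𝔉.pre.Mon (𝔉.base.obj T)),
        AlgebraicGeometry.Frobenioids.gpMap (𝔉.pre.pull a)
            (ThetaFrobenioid.gpMap (𝔉.pullAut g : 𝔉.pre.Mon (𝔉.base.obj T) →* 𝔉.pre.Mon (𝔉.base.obj T)) ξ) =
          ThetaFrobenioid.gpMap (𝔉.pullAut e : 𝔉.pre.Mon (𝔉.base.obj 𝔉.AN) →* 𝔉.pre.Mon (𝔉.base.obj 𝔉.AN))
            (AlgebraicGeometry.Frobenioids.gpMap (𝔉.pre.pull a) ξ) := by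
  obtain ⟨σ, hσ⟩ := exists_strv_over_of_strvSection hstrv hGal a g
  exact ⟨𝔉.strv σ, hσ, fun x => pull_pullAut_eq_pullAut_pull hσ x, fun ξ => gpMap_pull_gpMap_pullAut hσ ξ⟩

/-- **Prop. 5.3 (vi) READ AT `A_N`** (the LINK (d) step of "since `Ψ` [essentially] preserves the divisor of zeroes and
poles of `Θ̈`", Thm. 5.6 proof p.329 (PDF p.103)): if `Ψ^Φ_{A_⊚}` preserves the `Aut_C(A_⊚)`-orbit of `div(Θ̈)`
(`PreservesThetaDivisorOrbit`), then for every `a : A_N^bs → A_⊚^bs` the pull-back to `A_N` of `(Ψ^Φ_{A_⊚})^gp(div Θ̈)` is an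
`Aut_C(A_N)`-TRANSLATE of the pull-back of `div(Θ̈)`: `(a^*)^gp((Ψ^Φ)^gp div Θ̈) = (e ·)^gp ((a^*)^gp div Θ̈)` with
`e^bs ≫ a = a ≫ g^bs` for the orbit element `g` — under `StrvSection` and the torsor law `hGal`.
[cite: MochizukiEtTh2009, Prop 5.3 (vi) p.326 (PDF p.100); Thm 5.6 proof p.329 (PDF p.103)] -/
theorem exists_aut_AN_of_preservesThetaDivisorOrbit (hstrv : 𝔉.StrvSection)
    (hGal : ∀ (a : 𝔉.base.obj 𝔉.AN ⟶ 𝔉.base.obj 𝔉.Acirc) (t : 𝔉.base.obj 𝔉.Acirc ⟶ 𝔉.base.obj 𝔉.Acirc),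
      ∃ σ : Aut (𝔉.base.obj 𝔉.AN), σ.hom ≫ a = a ≫ t)
    (a : 𝔉.base.obj 𝔉.AN ⟶ 𝔉.base.obj 𝔉.Acirc) {𝔓 : FrobenioidThetaDivisors.DivisorPrimeData 𝔉} {Ψ : C ≌ C}
    {ι : Ψ.functor.obj 𝔉.Acirc ≅ 𝔉.Acirc} {eΦ : 𝔉.PhiAcirc ≃* 𝔉.pre.Mon (𝔉.base.obj (Ψ.functor.obj 𝔉.Acirc))}
    (hvi : FrobenioidThetaDivisors.PreservesThetaDivisorOrbit 𝔓 Ψ ι eΦ) :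
    ∃ (g : Aut 𝔉.Acirc) (e : Aut 𝔉.AN), 𝔉.base.map e.hom ≫ a = a ≫ 𝔉.base.map g.hom ∧
      ThetaFrobenioid.gpMap (FrobenioidThetaDivisors.psiPhi 𝔉 Ψ ι eΦ : 𝔉.PhiAcirc →* 𝔉.PhiAcirc) 𝔓.divTheta =
        ThetaFrobenioid.gpMap (𝔉.pullAut g : 𝔉.PhiAcirc →* 𝔉.PhiAcirc) 𝔓.divTheta ∧
      AlgebraicGeometry.Frobenioids.gpMap (𝔉.pre.pull a)
          (ThetaFrobenioid.gpMap (FrobenioidThetaDivisors.psiPhi 𝔉 Ψ ι eΦ : 𝔉.PhiAcirc →* 𝔉.PhiAcirc) 𝔓.divTheta) =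
        ThetaFrobenioid.gpMap (𝔉.pullAut e : 𝔉.pre.Mon (𝔉.base.obj 𝔉.AN) →* 𝔉.pre.Mon (𝔉.base.obj 𝔉.AN))
          (AlgebraicGeometry.Frobenioids.gpMap (𝔉.pre.pull a) 𝔓.divTheta) := by
  -- `div Θ̈` lies in its own orbit (`g = 1`), hence its `Ψ^Φ`-image lies in the orbit (Prop. 5.3 (vi))
  have hmem : ThetaFrobenioid.gpMap (FrobenioidThetaDivisors.psiPhi 𝔉 Ψ ι eΦ : 𝔉.PhiAcirc →* 𝔉.PhiAcirc) 𝔓.divTheta ∈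
      Set.range fun g : Aut 𝔉.Acirc => ThetaFrobenioid.gpMap (𝔉.pullAut g : 𝔉.PhiAcirc →* 𝔉.PhiAcirc) 𝔓.divTheta := by
    rw [← hvi]
    exact ⟨𝔓.divTheta, ⟨1, 𝔉.gpMap_pullAut_one_apply 𝔓.divTheta⟩, rfl⟩
  obtain ⟨g, hg⟩ := hmem
  obtain ⟨e, he, -, hgp⟩ := exists_aut_AN_over_of_strvSection hstrv hGal a g
  exact ⟨g, e, he, hg.symm, by rw [← hg]; exact hgp 𝔓.divTheta⟩

end Generic

/-! ## §4. At the GENUINE §5 data over `B^temp(Π^tp_X)⁰`: both inputs are theorems — LINK (d) unconditionally -/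

section ConnectedTemperoidData

open Literature.AnabelianGeometry.SemiGraphs Literature.AnabelianGeometry.SemiGraphs.GaloisObjects

universe u₀ v₀ w₀

variable {K : Type u₀} [Field K] {X : SemiGraphs.TemperedArithmeticGroup.{u₀} K} {D₀ : Type u₀} [Category.{v₀} D₀]
  {V : FrdIMonoidStub.{w₀}} {T₀ : RealifiedDivisorMonoids (D₀ := D₀) V}
  {VD : FrdICatStub.{u₀ + 1, u₀, w₀} (ConnectedPart (BTemp X.Pi))}
  {tf : TemperedFrobenioid T₀ (ConnectedPart (BTemp X.Pi)) VD} {hZ : tf.monoidType = MonoidType.Z}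
  {hP : ∀ A : (ConnectedPart (BTemp X.Pi))ᵒᵖ, IsPerfect (tf.Φ.carrier A)}
  {NH : Subgroup (Field.absoluteGaloisGroup K) → tf.category → ℕ+ → Prop} {A₀ : tf.category}
  {hA₀ : PreFrobenioid.IsFrobeniusTrivial tf.toElem A₀} {hA₀' : SemiGraphs.IsGaloisObj A₀.base.obj}
  {lv N : ℕ+} {T : ThetaEnvData.{max u₀ w₀} N}
  {pullFrac : ∀ {A A' : (BiKummerSetting.mkOfConnectedTemperoid X tf hZ hP NH A₀ hA₀ hA₀').C} (_ : A' ⟶ A),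
    (BiKummerSetting.mkOfConnectedTemperoid X tf hZ hP NH A₀ hA₀ hA₀').biratUnits A →
      (BiKummerSetting.mkOfConnectedTemperoid X tf hZ hP NH A₀ hA₀ hA₀').biratUnits A'}
  {θ : (BiKummerSetting.mkOfConnectedTemperoid X tf hZ hP NH A₀ hA₀ hA₀').biratUnits
    (BiKummerSetting.mkOfConnectedTemperoid X tf hZ hP NH A₀ hA₀ hA₀').Aodot}
  {Bl : (BiKummerSetting.mkOfConnectedTemperoid X tf hZ hP NH A₀ hA₀ hA₀').C}
  {Pl : (BiKummerSetting.mkOfConnectedTemperoid X tf hZ hP NH A₀ hA₀ hA₀').FractionPair θ Bl}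
  {Rl : (BiKummerSetting.mkOfConnectedTemperoid X tf hZ hP NH A₀ hA₀ hA₀').NthRoot θ Pl lv pullFrac}
  (h : ModelFrobenioid.Hypotheses tf.divisorMonoid tf.ratFnFunctor)
  (Q : FrobenioidTheta.ThetaSubquotientStub.{w₀} (ConnectedPart (BTemp X.Pi))) (odd_l : Odd (lv : ℕ))
  (R : (BiKummerSetting.mkOfConnectedTemperoid X tf hZ hP NH A₀ hA₀ hA₀').NthRoot Rl.root Rl.pair N pullFrac)
  (ιX : T.PiX ≃ₜ* X.Pi) (K' : Type w₀) [Field K'] (constEmb : K'ˣ →* tf.biratUnitsModel R.BN)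
  (constEmb_injective : Function.Injective constEmb)
  (hinvc : ∀ g : Aut R.AN.base,
    pull tf.divisorMonoid g.hom (ModelFrobenioid.div R.pair.num) = ModelFrobenioid.div R.pair.num)
  (hinvp : ∀ y : T.PiX, y ∈ T.PiYdd →
    pull tf.divisorMonoid ((BiKummerSetting.mkOfConnectedTemperoid X tf hZ hP NH A₀ hA₀ hA₀').galoisSurj R.AN.base
      R.αData.isGalois (ιX y)).hom (ModelFrobenioid.div R.pair.den) = ModelFrobenioid.div R.pair.den)

/-- **The torsor law `hGal` is a THEOREM at the genuine data**: `A_N^bs` is Galois (Def. 4.1 (iv)(a), carried by the root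
datum: `R.αData.isGalois`) in `B^temp(Π^tp_X)⁰`, so every endomorphism of any `T^bs` lifts along any `a : A_N^bs → T^bs`.
[cite: MochizukiSemiAnbd2006, Rmk 3.1.3 p.34] [cite: MochizukiEtTh2009, Def 4.1 (iv) p.313 (PDF p.87)] -/
theorem hGal_ofConnectedTemperoid (T' : (BiKummerSetting.mkOfConnectedTemperoid X tf hZ hP NH A₀ hA₀ hA₀').C)
    (a : R.AN.base ⟶ T'.base) (t : T'.base ⟶ T'.base) : ∃ σ : Aut R.AN.base, σ.hom ≫ a = a ≫ t :=
  exists_aut_over_of_isGaloisObj_connectedPart R.AN.base T'.base R.αData.isGalois a t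

include h in
/-- **LINK (d) at the genuine §4/§5 setting, NO residual hypothesis, MODEL currency** (no §5 superstructure needed): for the
`N`-domain `A_N := R.AN` of a root over `B^temp(Π^tp_X)⁰` (Frobenius-trivial with Galois base, Def. 4.1 (iv)(a)), EVERY object
`T` (e.g. `A_⊙`), every base arrow `a : A_N^bs → T^bs` (e.g. `(α_N ≫ α_l)^bs`) and every `g ∈ Aut_C(T)` there is
`e ∈ Aut_C(A_N)` OVER `g` — `e^bs ≫ a = a ≫ g^bs` — and then `a^* ∘ ((g⁻¹)^bs)^* = ((e⁻¹)^bs)^* ∘ a^*` on `Φ` (`pull`) and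
on `Φ^gp` (`pullGp`): [SemiAnbd] Rmk. 3.1.3 + [FrdI] Prop. 5.6 (`frobTrivSection`).
[cite: MochizukiEtTh2009, Thm 5.6 proof p.329 (PDF p.103)] [cite: MochizukiFrdI2008, Prop. 5.6 p.105] -/
theorem exists_aut_over_ofConnectedTemperoid
    (T' : (BiKummerSetting.mkOfConnectedTemperoid X tf hZ hP NH A₀ hA₀ hA₀').C) (a : R.AN.base ⟶ T'.base) (g : Aut T') :
    ∃ e : Aut R.AN, ModelFrobenioid.baseMap e.hom ≫ a = a ≫ ModelFrobenioid.baseMap g.hom ∧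
      ModelFrobenioid.baseMap e.inv ≫ a = a ≫ ModelFrobenioid.baseMap g.inv ∧
      (∀ x : tf.divisorMonoid.obj (op T'.base),
        pull tf.divisorMonoid a (pull tf.divisorMonoid (ModelFrobenioid.baseMap g.inv) x) =
          pull tf.divisorMonoid (ModelFrobenioid.baseMap e.inv) (pull tf.divisorMonoid a x)) ∧
      ∀ ξ : Algebra.GrothendieckGroup (tf.divisorMonoid.obj (op T'.base)),
        pullGp tf.divisorMonoid a (pullGp tf.divisorMonoid (ModelFrobenioid.baseMap g.inv) ξ) =
          pullGp tf.divisorMonoid (ModelFrobenioid.baseMap e.inv)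
            (pullGp tf.divisorMonoid a ξ) := by
  obtain ⟨e, he⟩ := ModelFrobenioid.exists_aut_baseMap_comp_eq_of_isGaloisObj h R.AN T' R.αData.isFrobeniusTrivial
    R.αData.isGalois a g
  have hinv : ModelFrobenioid.baseMap e.inv ≫ a = a ≫ ModelFrobenioid.baseMap g.inv :=
    map_inv_comp_eq_of_map_hom_comp_eq (ModelFrobenioid.baseFunctor tf.divisorMonoid tf.ratFnFunctor tf.divBNatTrans) he
  refine ⟨e, he, hinv, fun x => ?_, fun ξ => ?_⟩
  · rw [← pull_comp, ← pull_comp, hinv]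
  · rw [← pullGp_comp, ← pullGp_comp, hinv]

/-! ### Dictionary: the §5 actions of `ofConnectedTemperoidData` in model currency (all by `rfl`) -/

/-- `g · x = ((g⁻¹)^bs)^* x` with the MODEL pull-back. [cite: MochizukiEtTh2009, Prop 5.3 (vi) p.326 (PDF p.100)] -/
theorem pullAut_ofConnectedTemperoidData_apply {S' : (BiKummerSetting.mkOfConnectedTemperoid X tf hZ hP NH A₀ hA₀ hA₀').C}
    (g : Aut S') (x : tf.divisorMonoid.obj (op S'.base)) :
    (ofConnectedTemperoidData h Q odd_l R ιX K' constEmb constEmb_injective hinvc hinvp).pullAut g x =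
      pull tf.divisorMonoid (ModelFrobenioid.baseMap g.inv) x := rfl

/-- `(g ·)^gp = Φ^gp((g⁻¹)^bs)` (`pullGp`). [cite: MochizukiEtTh2009, Prop 5.3 (vi) p.326 (PDF p.100)] -/
theorem gpMap_pullAut_ofConnectedTemperoidData {S' : (BiKummerSetting.mkOfConnectedTemperoid X tf hZ hP NH A₀ hA₀ hA₀').C}
    (g : Aut S') (ξ : Algebra.GrothendieckGroup (tf.divisorMonoid.obj (op S'.base))) :
    ThetaFrobenioid.gpMap
        ((ofConnectedTemperoidData h Q odd_l R ιX K' constEmb constEmb_injective hinvc hinvp).pullAut g :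
          (ofConnectedTemperoidData h Q odd_l R ιX K' constEmb constEmb_injective hinvc hinvp).pre.Mon
              ((ofConnectedTemperoidData h Q odd_l R ιX K' constEmb constEmb_injective hinvc hinvp).base.obj S') →*
            (ofConnectedTemperoidData h Q odd_l R ιX K' constEmb constEmb_injective hinvc hinvp).pre.Mon
              ((ofConnectedTemperoidData h Q odd_l R ιX K' constEmb constEmb_injective hinvc hinvp).base.obj S')) ξ =
      pullGp tf.divisorMonoid (ModelFrobenioid.baseMap g.inv) ξ := rfl

/-- `(a^*)^gp = Φ^gp(a)` (`pullGp`) for the §5 pull-back. [cite: MochizukiFrdI2008, Thm. 5.2 (i) p.100] -/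
theorem gpMap_pull_ofConnectedTemperoidData {S' T' : ConnectedPart (BTemp X.Pi)} (a : S' ⟶ T')
    (ξ : Algebra.GrothendieckGroup (tf.divisorMonoid.obj (op T'))) :
    AlgebraicGeometry.Frobenioids.gpMap
        ((ofConnectedTemperoidData h Q odd_l R ιX K' constEmb constEmb_injective hinvc hinvp).pre.pull a) ξ =
      pullGp tf.divisorMonoid a ξ := rfl

/-- **Prop. 5.3 (vi) READ AT `A_N`, at the genuine §5 data, NO residual hypothesis beyond (vi) itself**: if
`Ψ^Φ_{A_⊚}` preserves the `Aut_C(A_⊚)`-orbit of `div(Θ̈)` (row F-0564 `PreservesThetaDivisorOrbit`, at the stub data `𝔓`),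
then for every `a : A_N^bs → A_⊚^bs` there are `g ∈ Aut_C(A_⊚)` and `e ∈ Aut_C(A_N)` over it (`e^bs ≫ a = a ≫ g^bs`) with
`(Ψ^Φ)^gp(div Θ̈) = g · div Θ̈` and, in MODEL currency, `Φ^gp(a)((Ψ^Φ)^gp div Θ̈) = Φ^gp((e⁻¹)^bs)(Φ^gp(a)(div Θ̈))` —
the form in which LINK (b) (`N·(div s^⊓_N − div s^⊔_N) = Φ^gp(a)(div Θ̈)`) turns "essentially preserves" into
abc-iut-L2-d4's `∃ e` at the pair.  [cite: MochizukiEtTh2009, Prop 5.3 (vi) p.326 (PDF p.100); Thm 5.6 proof p.329 (PDF p.103)] -/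
theorem exists_aut_AN_of_preservesThetaDivisorOrbit_ofConnectedTemperoidData
    (a : (ofConnectedTemperoidData h Q odd_l R ιX K' constEmb constEmb_injective hinvc hinvp).base.obj R.AN ⟶
      (ofConnectedTemperoidData h Q odd_l R ιX K' constEmb constEmb_injective hinvc hinvp).base.obj
        (ofConnectedTemperoidData h Q odd_l R ιX K' constEmb constEmb_injective hinvc hinvp).Acirc)
    {𝔓 : FrobenioidThetaDivisors.DivisorPrimeData
      (ofConnectedTemperoidData h Q odd_l R ιX K' constEmb constEmb_injective hinvc hinvp)}
    {Ψ : (BiKummerSetting.mkOfConnectedTemperoid X tf hZ hP NH A₀ hA₀ hA₀').C ≌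
      (BiKummerSetting.mkOfConnectedTemperoid X tf hZ hP NH A₀ hA₀ hA₀').C}
    {ι : Ψ.functor.obj (ofConnectedTemperoidData h Q odd_l R ιX K' constEmb constEmb_injective hinvc hinvp).Acirc ≅
      (ofConnectedTemperoidData h Q odd_l R ιX K' constEmb constEmb_injective hinvc hinvp).Acirc}
    {eΦ : (ofConnectedTemperoidData h Q odd_l R ιX K' constEmb constEmb_injective hinvc hinvp).PhiAcirc ≃*
      (ofConnectedTemperoidData h Q odd_l R ιX K' constEmb constEmb_injective hinvc hinvp).pre.Mon
        ((ofConnectedTemperoidData h Q odd_l R ιX K' constEmb constEmb_injective hinvc hinvp).base.obj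
          (Ψ.functor.obj (ofConnectedTemperoidData h Q odd_l R ιX K' constEmb constEmb_injective hinvc hinvp).Acirc))}
    (hvi : FrobenioidThetaDivisors.PreservesThetaDivisorOrbit 𝔓 Ψ ι eΦ) :
    ∃ (g : Aut (ofConnectedTemperoidData h Q odd_l R ιX K' constEmb constEmb_injective hinvc hinvp).Acirc) (e : Aut R.AN),
      ModelFrobenioid.baseMap e.hom ≫ a = a ≫ ModelFrobenioid.baseMap g.hom ∧
      ThetaFrobenioid.gpMap
          (FrobenioidThetaDivisors.psiPhi _ Ψ ι eΦ :
            (ofConnectedTemperoidData h Q odd_l R ιX K' constEmb constEmb_injective hinvc hinvp).PhiAcirc →*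
              (ofConnectedTemperoidData h Q odd_l R ιX K' constEmb constEmb_injective hinvc hinvp).PhiAcirc) 𝔓.divTheta =
        ThetaFrobenioid.gpMap
          ((ofConnectedTemperoidData h Q odd_l R ιX K' constEmb constEmb_injective hinvc hinvp).pullAut g :
            (ofConnectedTemperoidData h Q odd_l R ιX K' constEmb constEmb_injective hinvc hinvp).PhiAcirc →*
              (ofConnectedTemperoidData h Q odd_l R ιX K' constEmb constEmb_injective hinvc hinvp).PhiAcirc) 𝔓.divTheta ∧
      pullGp tf.divisorMonoid a
          (ThetaFrobenioid.gpMap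
            (FrobenioidThetaDivisors.psiPhi _ Ψ ι eΦ :
              (ofConnectedTemperoidData h Q odd_l R ιX K' constEmb constEmb_injective hinvc hinvp).PhiAcirc →*
                (ofConnectedTemperoidData h Q odd_l R ιX K' constEmb constEmb_injective hinvc hinvp).PhiAcirc) 𝔓.divTheta) =
        pullGp tf.divisorMonoid (ModelFrobenioid.baseMap e.inv)
          (pullGp tf.divisorMonoid a 𝔓.divTheta) := by
  obtain ⟨g, e, he, hg, hgp⟩ :=
    (ofConnectedTemperoidData h Q odd_l R ιX K' constEmb constEmb_injective hinvc hinvp).exists_aut_AN_of_preservesThetaDivisorOrbit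
      (strvSection_ofConnectedTemperoidData h Q odd_l R ιX K' constEmb constEmb_injective hinvc hinvp)
      (hGal_ofConnectedTemperoid R _) a hvi
  exact ⟨g, e, he, hg, hgp⟩

end ConnectedTemperoidData

end ThetaFrobenioid

end Literature.AnabelianGeometry.EtaleTheta
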